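import Mathlib
import HarnessLib
import Summits.NavierStokesRegularity.NavierStokesRegularity.Theorems.PoloidalWindowDoorPoloidalWindowRigidityTimeHeightShearNormalForm
import Summits.NavierStokesRegularity.NavierStokesRegularity.Theorems.PoloidalWindowDoorPoloidalWindowRigidityVerticalShearGerm

/-!
# Route `PoloidalWindowDoor`, item `LrcModEntire` (stmt-NavierStokesRegularity-20428), line twist_split — v17 closer, H7a:
# A NON-TRIVIAL (TH) CLASS PROFILE HAS A SLOPE WINDOW (`slopeWindow_of_nonzero`)

LEAD-lineage ns-poloidal-K2-p3 g18 (`--supports stmt-NavierStokesRegularity-20428 --as helper`).  The trichotomy of the LEAD's v17 programme (02:55Z, H7) as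
one class-level lemma: a profile of the route's Type-I ancient mild class, poloidal, carrying the GLOBAL (TH) bilinear identity, and not identically zero, has at the
slice `t = −1` an open height window `(c₀ − η, c₀ + η)` on which every plane is proportional-shear with a NON-ZERO slope `μ(z)`:
`∂₂W_b(−1,y) = μ(y₂)·∂_bW₂(−1,y)` (`b = 0,1`), `μ ≠ 0`.

Proof (every exit a tree theorem): per plane, the bilinear identity gives «horizontally flat or proportional-shear»
(`…TimeHeightShearNormalForm.planeShear_or_flat_of_minor`).  If some point `y` carries `∂_bW₂(y) ≠ 0` AND `∂₂W_b(y) ≠ 0` for one horizontal index `b`, continuity of the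
first derivatives along the vertical line through `y` gives a height window on which both stay non-zero; there each plane is non-flat, hence proportional-shear, and its
slope is the (non-zero) ratio at the moved witness.  Otherwise every plane is horizontally flat or has zero vertical shear: if all planes are flat, `W ≡ 0`
(`…TimeHeightShearNormalForm.eq_zero_of_flatPlanes_open`); if one is not, a whole height window is not (continuity), the vertical shear vanishes on that open slab, and
`W ≡ 0` (`…VerticalShearGerm.eq_zero_of_verticalShear_eq_zero_on_open`) — contradiction either way.

WHAT THIS IS NOT: not a claim about Navier–Stokes regularity; a helper of the closable v17 child `stub_Q4curvedAperiodicVerticalFlatLimit` (consumed by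
`…Q4CurvedFlatCurtainAnywhere` / `…Q4CurvedFlatLimit`); items 20428 / 19708 / 27893 OPEN (bears_on LADDER-NS N0).
-/

noncomputable section

set_option linter.dupNamespace false
set_option linter.style.longLine false

namespace Summit.NavierStokesRegularity.NavierStokesRegularity.Theorems.PoloidalWindowDoorLrcModEntireQ4CurvedSlopeWindow

open Set Function Filter Topology Metric
open scoped RealInnerProductSpace InnerProductSpace ContDiff
open Literature.Analysis Literature.Analysis.FluidPDE Literature.Analysis.UnboundedOperators
open Summit.NavierStokesRegularity.NavierStokesRegularity.Theorems.LocalSineTubeDoorProfileAlignedWindowRigidityAncient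
open Summit.NavierStokesRegularity.NavierStokesRegularity.Theorems.PoloidalWindowDoorPoloidalWindowRigidityTimeHeightShearNormalForm
open Summit.NavierStokesRegularity.NavierStokesRegularity.Theorems.PoloidalWindowDoorPoloidalWindowRigidityVerticalShearGerm

/-- Continuity along a vertical line of one Jacobian entry of a `C¹` map. -/
theorem continuous_entry_line {V : EuclideanSpace ℝ (Fin 3) → EuclideanSpace ℝ (Fin 3)} (hV : ContDiff ℝ 1 V)
    (y : EuclideanSpace ℝ (Fin 3)) (c : ℝ) (u : EuclideanSpace ℝ (Fin 3)) (i : Fin 3) :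
    Continuous fun z : ℝ => fderiv ℝ V (y + (z - c) • EuclideanSpace.single 2 (1 : ℝ)) u i := by
  have hf : Continuous (fderiv ℝ V) := hV.continuous_fderiv one_ne_zero
  have hl : Continuous fun z : ℝ => y + (z - c) • EuclideanSpace.single 2 (1 : ℝ) := by fun_prop
  have h1 : Continuous fun z : ℝ => fderiv ℝ V (y + (z - c) • EuclideanSpace.single 2 (1 : ℝ)) u :=
    (hf.comp hl).clm_apply continuous_const
  exact (EuclideanSpace.proj (𝕜 := ℝ) i).continuous.comp h1

/-- ★ **A NON-TRIVIAL (TH) CLASS PROFILE HAS A SLOPE WINDOW WITH NON-ZERO SLOPE at `t = −1`.**  See the module docstring. -/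
theorem slopeWindow_of_nonzero {C : ℝ} {W : ℝ → EuclideanSpace ℝ (Fin 3) → EuclideanSpace ℝ (Fin 3)}
    (hrate : HasTypeITimeDecay C W) (hcont : ContinuousOn (uncurry W) (Iio (0 : ℝ) ×ˢ univ))
    (hmild : ∀ s t : ℝ, s < t → t < 0 → ∀ x, W t x = heatExtension (W s) (t - s) x - oseenDuhamel 1 s W W t x)
    (hdiv : ∀ t < 0, VectorCalculus.IsDivFree (W t))
    (hpol : ∀ s < 0, ∀ q, ⟪curl (W s) q, EuclideanSpace.single 2 1⟫_ℝ = 0)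
    (hbil : ∀ t < 0, ∀ x x' : EuclideanSpace ℝ (Fin 3), x 2 = x' 2 → ∀ b c : Fin 3, b ≠ 2 → c ≠ 2 →
      fderiv ℝ (W t) x (EuclideanSpace.single 2 1) b * fderiv ℝ (W t) x' (EuclideanSpace.single c 1) 2 =
        fderiv ℝ (W t) x' (EuclideanSpace.single 2 1) c * fderiv ℝ (W t) x (EuclideanSpace.single b 1) 2)
    (hne : ∃ t < 0, ∃ x, W t x ≠ 0) :
    ∃ c₀ η : ℝ, 0 < η ∧ ∃ μ : ℝ → ℝ, (∀ z ∈ Set.Ioo (c₀ - η) (c₀ + η), μ z ≠ 0) ∧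
      ∀ y : EuclideanSpace ℝ (Fin 3), y 2 ∈ Set.Ioo (c₀ - η) (c₀ + η) → ∀ b : Fin 3, b ≠ 2 →
        fderiv ℝ (W (-1)) y (EuclideanSpace.single 2 1) b = μ (y 2) * fderiv ℝ (W (-1)) y (EuclideanSpace.single b 1) 2 := by
  have hs : (-1 : ℝ) < 0 := by norm_num
  set e₂ : EuclideanSpace ℝ (Fin 3) := EuclideanSpace.single 2 (1 : ℝ) with he₂
  -- `W ≢ 0` as the negation of the Liouville conclusions
  have hW0 : ¬ ∀ t < 0, ∀ x, W t x = 0 := by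
    obtain ⟨t₀, ht₀, x₀, hx₀⟩ := hne
    exact fun h => hx₀ (h t₀ ht₀ x₀)
  -- smoothness of the slice
  have hAn : AnalyticOnNhd ℝ (W (-1)) univ := analyticOnNhd_slice hcont (bdd_of_hasTypeITimeDecay hrate) hmild hs
  have hC1 : ContDiff ℝ 1 (W (-1)) := hAn.contDiff.of_le le_top
  -- per-plane dichotomy at time `−1`
  have hplane : ∀ c : ℝ,
      (∀ y : EuclideanSpace ℝ (Fin 3), y 2 = c →
          fderiv ℝ (W (-1)) y (EuclideanSpace.single 0 1) 2 = 0 ∧ fderiv ℝ (W (-1)) y (EuclideanSpace.single 1 1) 2 = 0) ∨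
        ∃ μ : ℝ, ∀ y : EuclideanSpace ℝ (Fin 3), y 2 = c → ∀ b : Fin 3, b ≠ 2 →
          fderiv ℝ (W (-1)) y (EuclideanSpace.single 2 1) b = μ * fderiv ℝ (W (-1)) y (EuclideanSpace.single b 1) 2 :=
    fun c => planeShear_or_flat_of_minor (V := W (-1)) (c := c)
      fun y y' hy hy' b b' hb hb' => hbil (-1) hs y y' (hy.trans hy'.symm) b b' hb hb'
  -- the height line through a point
  have hline2 : ∀ (y : EuclideanSpace ℝ (Fin 3)) (c z : ℝ), y 2 = c → (y + (z - c) • e₂) 2 = z := by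
    intro y c z hy
    simp [he₂, hy]
  by_cases hP : ∃ (y : EuclideanSpace ℝ (Fin 3)) (b : Fin 3), b ≠ 2 ∧
      fderiv ℝ (W (-1)) y (EuclideanSpace.single b 1) 2 ≠ 0 ∧ fderiv ℝ (W (-1)) y e₂ b ≠ 0
  · -- CASE (a1): a window with non-zero slope around the height of the witness
    obtain ⟨y, b, hb, hf0, hg0⟩ := hP
    set c : ℝ := y 2 with hc
    set f : ℝ → ℝ := fun z => fderiv ℝ (W (-1)) (y + (z - c) • e₂) (EuclideanSpace.single b 1) 2 with hf
    set g : ℝ → ℝ := fun z => fderiv ℝ (W (-1)) (y + (z - c) • e₂) e₂ b with hg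
    have hfc : Continuous f := continuous_entry_line hC1 y c _ 2
    have hgc : Continuous g := continuous_entry_line hC1 y c _ b
    have hy0 : y + (c - c) • e₂ = y := by simp
    have hfc0 : f c ≠ 0 := by simpa [hf, hy0] using hf0
    have hgc0 : g c ≠ 0 := by simpa [hg, hy0] using hg0
    -- a common window on which `f ≠ 0` and `g ≠ 0`
    have hfo : IsOpen {z : ℝ | f z ≠ 0} := isOpen_ne_fun hfc continuous_const
    have hgo : IsOpen {z : ℝ | g z ≠ 0} := isOpen_ne_fun hgc continuous_const
    obtain ⟨η, hη, hball⟩ := Metric.isOpen_iff.1 (hfo.inter hgo) c ⟨hfc0, hgc0⟩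
    refine ⟨c, η, hη, fun z => g z / f z, fun z hz => ?_, fun y' hy' b' hb' => ?_⟩
    · have hz' : z ∈ Metric.ball c η := by
        rw [Metric.mem_ball, Real.dist_eq, abs_lt]; constructor <;> linarith [hz.1, hz.2]
      obtain ⟨hfz, hgz⟩ := hball hz'
      exact div_ne_zero hgz hfz
    · set z : ℝ := y' 2 with hz
      have hz' : z ∈ Metric.ball c η := by
        rw [Metric.mem_ball, Real.dist_eq, abs_lt]; constructor <;> linarith [hy'.1, hy'.2]
      obtain ⟨hfz, hgz⟩ := hball hz'
      -- the plane `z` is not flat (witness `y + (z − c)e₂`), hence proportional-shear with the ratio slope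
      have hw2 : (y + (z - c) • e₂) 2 = z := hline2 y c z rfl
      rcases hplane z with hflat | ⟨μ', hμ'⟩
      · exfalso
        have h0 := hflat (y + (z - c) • e₂) hw2
        fin_cases b
        · exact hfz (by simpa [hf] using h0.1)
        · exact hfz (by simpa [hf] using h0.2)
        · exact hb rfl
      · have hrat : μ' = g z / f z := by
          have h1 := hμ' (y + (z - c) • e₂) hw2 b hb
          rw [eq_div_iff hfz]
          simpa [hf, hg, he₂] using h1.symm
        show _ = g z / f z * _
        rw [← hrat]
        exact hμ' y' rfl b' hb'
  · -- CASE ¬P: every plane is horizontally flat or has zero vertical shear ⇒ `W ≡ 0`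
    exfalso
    push Not at hP
    -- zero vertical shear on every non-flat plane
    have hshear : ∀ c : ℝ, (∃ (y₁ : EuclideanSpace ℝ (Fin 3)) (b₁ : Fin 3), y₁ 2 = c ∧ b₁ ≠ 2 ∧
        fderiv ℝ (W (-1)) y₁ (EuclideanSpace.single b₁ 1) 2 ≠ 0) →
        ∀ y : EuclideanSpace ℝ (Fin 3), y 2 = c →
          fderiv ℝ (W (-1)) y e₂ 0 = 0 ∧ fderiv ℝ (W (-1)) y e₂ 1 = 0 := by
      intro c ⟨y₁, b₁, hy₁, hb₁, hne₁⟩ y hy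
      rcases hplane c with hflat | ⟨μ', hμ'⟩
      · exfalso
        have h0 := hflat y₁ hy₁
        fin_cases b₁
        · exact hne₁ (by simpa using h0.1)
        · exact hne₁ (by simpa using h0.2)
        · exact hb₁ rfl
      · -- the slope vanishes: `∂₂W_{b₁}(y₁) = 0` by ¬P, and `∂₂W_{b₁}(y₁) = μ' ∂_{b₁}W₂(y₁)`
        have hz1 : fderiv ℝ (W (-1)) y₁ e₂ b₁ = 0 := hP y₁ b₁ hb₁ hne₁
        have hμ0 : μ' = 0 := by
          have h1 := hμ' y₁ hy₁ b₁ hb₁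
          rw [hz1] at h1
          exact (mul_eq_zero.1 h1.symm).resolve_right hne₁
        refine ⟨?_, ?_⟩
        · have h := hμ' y hy 0 (by decide); rw [hμ0, zero_mul] at h; simpa [he₂] using h
        · have h := hμ' y hy 1 (by decide); rw [hμ0, zero_mul] at h; simpa [he₂] using h
    by_cases hall : ∀ c : ℝ, ∀ y : EuclideanSpace ℝ (Fin 3), y 2 = c →
        fderiv ℝ (W (-1)) y (EuclideanSpace.single 0 1) 2 = 0 ∧ fderiv ℝ (W (-1)) y (EuclideanSpace.single 1 1) 2 = 0
    · -- all planes flat ⇒ `W ≡ 0`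
      exact hW0 (eq_zero_of_flatPlanes_open hrate hcont hmild hdiv hpol hs isOpen_univ univ_nonempty fun c _ => hall c)
    · -- a non-flat plane ⇒ a non-flat height window ⇒ zero vertical shear on an open slab ⇒ `W ≡ 0`
      push Not at hall
      obtain ⟨c, y₁, hy₁, hne₁⟩ := hall
      -- a horizontal index with `∂_{b₁}W₂(y₁) ≠ 0`
      have hidx : ∃ b₁ : Fin 3, b₁ ≠ 2 ∧ fderiv ℝ (W (-1)) y₁ (EuclideanSpace.single b₁ 1) 2 ≠ 0 := by
        by_cases h0 : fderiv ℝ (W (-1)) y₁ (EuclideanSpace.single 0 1) 2 = 0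
        · exact ⟨1, by decide, hne₁ h0⟩
        · exact ⟨0, by decide, h0⟩
      obtain ⟨b₁, hb₁, hf0⟩ := hidx
      set f : ℝ → ℝ := fun z => fderiv ℝ (W (-1)) (y₁ + (z - c) • e₂) (EuclideanSpace.single b₁ 1) 2 with hf
      have hfc : Continuous f := continuous_entry_line hC1 y₁ c _ 2
      have hy0 : y₁ + (c - c) • e₂ = y₁ := by simp
      have hfc0 : f c ≠ 0 := by simpa [hf, hy0] using hf0
      obtain ⟨η, hη, hball⟩ := Metric.isOpen_iff.1 (isOpen_ne_fun hfc continuous_const) c hfc0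
      -- the open slab of heights in the window
      set S : Set (EuclideanSpace ℝ (Fin 3)) := {y | y 2 ∈ Metric.ball c η} with hS
      have hSo : IsOpen S := Metric.isOpen_ball.preimage (EuclideanSpace.proj (𝕜 := ℝ) (2 : Fin 3)).continuous
      have hSne : S.Nonempty := ⟨y₁, by simpa [hS, hy₁] using hη⟩
      refine hW0 (eq_zero_of_verticalShear_eq_zero_on_open hrate hcont hmild hdiv hs hSo hSne fun y hy => ?_)
      have hz : y 2 ∈ Metric.ball c η := hy
      have hw : f (y 2) ≠ 0 := hball hz
      have hw2 : (y₁ + (y 2 - c) • e₂) 2 = y 2 := hline2 y₁ c (y 2) hy₁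
      have h := hshear (y 2) ⟨y₁ + (y 2 - c) • e₂, b₁, hw2, hb₁, by simpa [hf] using hw⟩ y rfl
      simpa [he₂] using h

end Summit.NavierStokesRegularity.NavierStokesRegularity.Theorems.PoloidalWindowDoorLrcModEntireQ4CurvedSlopeWindow

end
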